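import Literature.Computability.Cryptography.CubicClassSamplingLawSlices
import Literature.Computability.Cryptography.PeriodFindingShiftCellLaw
import Literature.Computability.Cryptography.PeriodFindingIdealisedTable
import Literature.Computability.Cryptography.PeriodFindingSamplingNumerics
import HarnessLib

/-!
# The per-unit sampling law of a shift-cell / coset table: the three parts

Topic `Computability/Cryptography`; theorem-only file, no named facts. The parts of `ClaimSamplingLaw`
(`CubicClassSamplingSpecs.lean`) for the weight `w₁ c = corrMass Q F₁ c / Q²` of the IDEALISED table
`F₁ v = C_{cls(v mod W)}((σ_{v mod W} + v/W) mod 2^s)` (`W = (2^ℓe)^T`, `Q = W·2^s·2^(top+(ℓy−s))`) and the coupling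
`μ'_t = μ_t + 2^-s (2^ℓe)^-(T−t)`, from the structure `ShiftCellCosetTable` and the thresholds of `ClaimSamplingLaw`:

* `samplingLaw_tv` — `∑_c |corrMass Q F c/Q² − w₁ c| ≤ 2^-e₆` (bad coins and defects, `sum_abs_corrMass_sub_idealised_le`);
* `samplingLaw_inaccurate` — the characters accurate for no dual vector carry `≤ 2^-e₆` of `w₁` (tail of the circle
  frequency `shiftCell_tail_mass_le` + off-ball mass `shiftCell_offBall_mass_sum_le` + `not_mem_AccAll_slice_imp`);
* `samplingLaw_uniform` — for every residue `kk` and dual vector `ξ`, the `w₁`-mass accurate for `(kk, ξ)` is at most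
  `(1 + 1/8)/[ℤ^T:Λ]` of the mass accurate for `kk` (`shiftCell_ball_mass_le` + `filter_range_Acc_eq_image`).
[Hallgren 2005, §4; Kitaev 1995, §4]

## References

* S. Hallgren, STOC 2005, §4. [Hallgren2005]
* A. Yu. Kitaev, arXiv:quant-ph/9511026 (1995), §4. [Kitaev1995]
-/

noncomputable section

open scoped Classical

namespace Literature.Computability.Cryptography

namespace CubicClassSampling

open CubicClassPost Finset PeriodFinding

/-- **Part TV**: the unit law `corrMass Q F / Q²` is within `2^-e₆` (total variation) of the idealised weight `w₁`.
[cite: Hallgren2005, §4] -/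
theorem samplingLaw_tv : ∀ {T ℓe s ℓy ℓκ top Ncell e₆ : ℕ} {Ω : Type*} [DecidableEq Ω] {F : ℕ → Ω}
    {Λ : AddSubgroup (Fin T → ℤ)} {F₀ : ℕ → Ω} {cls σ : ℕ → ℕ} {C : ℕ → ℕ → Ω} {y : ℕ → ℝ} {μ : Fin T → ℝ}
    {Badκ D : Finset ℕ} {εκ εD : ℝ}, ShiftCellCosetTable T ℓe s ℓy ℓκ Ncell F Λ F₀ cls σ C y μ Badκ D εκ εD →
    s ≤ ℓy → ℓκ ≤ top → εκ + εD ≤ (1 / 2) ^ (2 * e₆ + 8) →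
    ∑ c ∈ Finset.range ((2 ^ ℓe) ^ T * (2 ^ s * 2 ^ (top + (ℓy - s)))),
      |corrMass ((2 ^ ℓe) ^ T * (2 ^ s * 2 ^ (top + (ℓy - s)))) F c /
          (((2 ^ ℓe) ^ T * (2 ^ s * 2 ^ (top + (ℓy - s))) : ℕ) : ℝ) ^ 2 -
        corrMass ((2 ^ ℓe) ^ T * (2 ^ s * 2 ^ (top + (ℓy - s))))
          (fun v => C (cls (v % (2 ^ ℓe) ^ T)) ((σ (v % (2 ^ ℓe) ^ T) + v / (2 ^ ℓe) ^ T) % 2 ^ s)) c /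
          (((2 ^ ℓe) ^ T * (2 ^ s * 2 ^ (top + (ℓy - s))) : ℕ) : ℝ) ^ 2| ≤ (1 / 2) ^ e₆ := by
  intro T ℓe s ℓy ℓκ top Ncell e₆ Ω _ F Λ F₀ cls σ C y μ Badκ D εκ εD hTab hs hℓκ hε
  obtain ⟨hBad, hcoin, hDc, hdef, -, -, -, -, -⟩ := hTab
  have hW : 0 < (2 ^ ℓe) ^ T := by positivity
  have hQeq : (2 ^ ℓe) ^ T * (2 ^ s * 2 ^ (top + (ℓy - s))) = (2 ^ ℓe) ^ T * 2 ^ ℓy * 2 ^ top := by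
    rw [mul_assoc]; congr 1; rw [← pow_add, ← pow_add]; congr 1; omega
  rw [hQeq]
  set Q : ℕ := (2 ^ ℓe) ^ T * 2 ^ ℓy * 2 ^ top with hQ
  have hQpos : 0 < Q := by positivity
  have hQR : (0 : ℝ) < (Q : ℝ) := by exact_mod_cast hQpos
  have hBad' : (Badκ.card : ℝ) ≤ εκ * ((2 ^ ℓκ : ℕ) : ℝ) := by push_cast; exact hBad
  have htv := sum_abs_corrMass_sub_idealised_le (S := 2 ^ s) hW (pow_pos (by norm_num) ℓy) (pow_dvd_pow 2 hs) F F₀ cls σ C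
    Badκ D hcoin hdef (pow_pos (by norm_num) ℓκ) (pow_dvd_pow 2 hℓκ) (pow_pos (by norm_num) top) hBad' hDc
  rw [← hQ] at htv
  have hterm : ∀ c : ℕ, |corrMass Q F c / (Q : ℝ) ^ 2 -
      corrMass Q (fun v => C (cls (v % (2 ^ ℓe) ^ T)) ((σ (v % (2 ^ ℓe) ^ T) + v / (2 ^ ℓe) ^ T) % 2 ^ s)) c /
        (Q : ℝ) ^ 2| = |corrMass Q F c -
      corrMass Q (fun v => C (cls (v % (2 ^ ℓe) ^ T)) ((σ (v % (2 ^ ℓe) ^ T) + v / (2 ^ ℓe) ^ T) % 2 ^ s)) c| /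
        (Q : ℝ) ^ 2 := by
    intro c
    rw [← sub_div, abs_div, abs_of_pos (by positivity : (0 : ℝ) < (Q : ℝ) ^ 2)]
  simp_rw [hterm]
  rw [← sum_div, div_le_iff₀ (by positivity)]
  refine htv.trans ?_
  have hnum := samplingLaw_tv_numerics (e₆ := e₆) hε
  nlinarith [hnum, hQR, Real.sqrt_nonneg (2 * (εκ + εD))]

section Parts

variable {T ℓe s ℓy ℓκ top Ncell hB u e₆ K₀ : ℕ} {Ω : Type*} [DecidableEq Ω] {F : ℕ → Ω}
  {Λ : AddSubgroup (Fin T → ℤ)} [Λ.FiniteIndex] {F₀ : ℕ → Ω} {cls σ : ℕ → ℕ} {C : ℕ → ℕ → Ω}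
  {y : ℕ → ℝ} {μ : Fin T → ℝ} {Badκ D : Finset ℕ} {εκ εD : ℝ}
  (hTab : ShiftCellCosetTable T ℓe s ℓy ℓκ Ncell F Λ F₀ cls σ C y μ Badκ D εκ εD)
  (hT : 1 ≤ T) (hs : s ≤ ℓy) (hℓκ : ℓκ ≤ top) (hhB : Λ.index ≤ hB) (h1 : 1 ≤ hB)
  (hεκ : 0 ≤ εκ) (hεD : 0 ≤ εD) (hε : εκ + εD ≤ (1 / 2) ^ (2 * e₆ + 8))
  (hu : 2 ^ (e₆ + 8) * hB * (T + 1) ≤ u) (hM : hB ^ 3 * (2 * u) ^ T * 2 ^ (s + e₆ + 40) ≤ 2 ^ ℓe)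
  (hN : Ncell * hB * 2 ^ (2 * e₆ + 16) ≤ 2 ^ s)
  (hKlo : K₀ * (2 ^ (e₆ + 8) * hB) ≤ 2 ^ s) (hKhi : 2 ^ s ≤ 2 * K₀ * (2 ^ (e₆ + 8) * hB))

include hTab hT hhB h1 hu hM hN hKlo hKhi in
/-- **Part (a)**: the characters accurate for NO dual vector of `Λ` carry `w₁`-mass `≤ 2^-e₆`. [cite: Hallgren2005, §4] -/
theorem samplingLaw_inaccurate :
    ∑ c ∈ (range (2 ^ (top + (ℓy - s)) * (2 ^ s * 2 ^ (ℓe * T)))).filter (fun c => c ∉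
        AccAll ⟨T, ℓe, s, ℓy - s, top, K₀, hB⟩ Λ
          (fun t => μ t + 1 / (((2 ^ s : ℕ) : ℝ) * ((2 ^ ℓe : ℕ) : ℝ) ^ (T - (t : ℕ)))) (2 * (u : ℝ) / ((2 ^ ℓe : ℕ) : ℝ))),
      corrMass ((2 ^ ℓe) ^ T * (2 ^ s * 2 ^ (top + (ℓy - s))))
          (fun v => C (cls (v % (2 ^ ℓe) ^ T)) ((σ (v % (2 ^ ℓe) ^ T) + v / (2 ^ ℓe) ^ T) % 2 ^ s)) c /
        (((2 ^ ℓe) ^ T * (2 ^ s * 2 ^ (top + (ℓy - s))) : ℕ) : ℝ) ^ 2 ≤ (1 / 2) ^ e₆ := by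
  obtain ⟨-, -, -, -, hcls, hC, hσ, hy, hcells⟩ := hTab
  obtain ⟨hu3, huM, hK1⟩ := samplingLaw_side (s := s) hT h1 hu hM hKhi
  have hT0 : 0 < T := hT
  have hMpos : 0 < 2 ^ ℓe := pow_pos (by norm_num) _
  have hS : 0 < 2 ^ s := pow_pos (by norm_num) _
  have ha : 0 < 2 ^ (top + (ℓy - s)) := pow_pos (by norm_num) _
  have hW : 0 < (2 ^ ℓe) ^ T := pow_pos hMpos _
  have hWd : 2 ^ (ℓe * T) = (2 ^ ℓe) ^ T := pow_mul 2 ℓe T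
  have hK2 : 2 * K₀ < 2 ^ s := by
    have h256 : 256 ≤ 2 ^ (e₆ + 8) * hB := by
      calc 256 = 2 ^ 8 * 1 := by norm_num
        _ ≤ 2 ^ (e₆ + 8) * hB := Nat.mul_le_mul (Nat.pow_le_pow_right (by norm_num) (by omega)) h1
    nlinarith
  -- the idealised table, its weight, and the hypotheses of the bricks
  set F₁ : ℕ → Ω := fun v => C (cls (v % (2 ^ ℓe) ^ T)) ((σ (v % (2 ^ ℓe) ^ T) + v / (2 ^ ℓe) ^ T) % 2 ^ s) with hF₁def
  set Q : ℕ := (2 ^ ℓe) ^ T * (2 ^ s * 2 ^ (top + (ℓy - s))) with hQ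
  have hF₁ : ∀ E < (2 ^ ℓe) ^ T, ∀ j < 2 ^ s * 2 ^ (top + (ℓy - s)), F₁ (E + (2 ^ ℓe) ^ T * j) = C (cls E) ((σ E + j) % 2 ^ s) :=
    fun E hE j _ => idealised_shiftCell hW cls σ C E hE j
  have hy' : ∀ E < (2 ^ ℓe) ^ T, ∀ E' < (2 ^ ℓe) ^ T, cls E = cls E' → ∃ z : ℤ, y E' - y E + ((2 ^ s : ℕ) : ℝ) *
      ∑ t : Fin T, μ t * (((E' / (2 ^ ℓe) ^ (t : ℕ) % 2 ^ ℓe : ℕ) : ℝ) - ((E / (2 ^ ℓe) ^ (t : ℕ) % 2 ^ ℓe : ℕ) : ℝ)) =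
      ((2 ^ s : ℕ) : ℝ) * z := by
    intro E hE E' hE' h
    obtain ⟨z, hz⟩ := hy E hE E' hE' h
    exact ⟨z, by push_cast; exact hz⟩
  have hQR : (0 : ℝ) < (Q : ℝ) := by rw [hQ]; positivity
  have hQsq : ((Q : ℕ) : ℝ) ^ 2 = ((2 ^ (top + (ℓy - s)) : ℕ) : ℝ) ^ 2 * ((2 ^ ℓe : ℕ) : ℝ) ^ (2 * T) *
      ((2 ^ s : ℕ) : ℝ) ^ 2 := by
    rw [hQ]; push_cast; ring
  -- the weight vanishes off the multiples of `a`
  have hvan : ∀ c : ℕ, c < 2 ^ (top + (ℓy - s)) * (2 ^ s * 2 ^ (ℓe * T)) → ¬ 2 ^ (top + (ℓy - s)) ∣ c →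
      corrMass Q F₁ c / (Q : ℝ) ^ 2 = 0 := by
    intro c _ hnd
    rw [hQ, corrMass_shiftCell_eq_zero hMpos hS ha cls σ C hC F₁ hF₁ (c : ℤ)
      (fun h => hnd (by exact_mod_cast h)), zero_div]
  rw [sum_filter_range_mul_eq ha _ (fun c => corrMass Q F₁ c / (Q : ℝ) ^ 2) hvan, sum_filter_range_mul_eq_sum_sum]
  -- tail residues and signed residues
  set tail : ℕ → Prop := fun k₀ => K₀ < k₀ ∧ K₀ < 2 ^ s - k₀ with htail
  set kkf : ℕ → ℤ := fun k₀ => if k₀ ≤ K₀ then (k₀ : ℤ) else (k₀ : ℤ) - (2 ^ s : ℕ) with hkkf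
  set off : ℕ → ℕ → Prop := fun k₀ ν => ¬ ∃ ζ : Fin T → ℚ, ((∀ t, 0 ≤ ζ t ∧ ζ t < 1) ∧
      ∀ v ∈ Λ, ∃ z : ℤ, ∑ t, ζ t * (v t : ℚ) = z) ∧
      ∀ t : Fin T, |(k₀ : ℝ) / (((2 ^ s : ℕ) : ℝ) * ((2 ^ ℓe : ℕ) : ℝ) ^ (T - (t : ℕ))) + (kkf k₀ : ℝ) * μ t + (ζ t : ℝ) +
          (ν : ℝ) / ((2 ^ ℓe : ℕ) : ℝ) ^ (T - (t : ℕ)) -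
        round ((k₀ : ℝ) / (((2 ^ s : ℕ) : ℝ) * ((2 ^ ℓe : ℕ) : ℝ) ^ (T - (t : ℕ))) + (kkf k₀ : ℝ) * μ t + (ζ t : ℝ) +
          (ν : ℝ) / ((2 ^ ℓe : ℕ) : ℝ) ^ (T - (t : ℕ)))| ≤ 2 * (u : ℝ) / ((2 ^ ℓe : ℕ) : ℝ) with hoffdef
  have hw0 : ∀ c : ℕ, 0 ≤ corrMass Q F₁ c / (Q : ℝ) ^ 2 := fun c => div_nonneg (corrMass_nonneg _ _ _) (sq_nonneg _)
  -- pointwise: inaccurate ⟹ tail, or (not tail and off-ball)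
  have hpt : ∀ ν ∈ range (2 ^ (ℓe * T)),
      ∑ k₀ ∈ (range (2 ^ s)).filter (fun k₀ => 2 ^ (top + (ℓy - s)) * (k₀ + 2 ^ s * ν) ∉
        AccAll ⟨T, ℓe, s, ℓy - s, top, K₀, hB⟩ Λ
          (fun t => μ t + 1 / (((2 ^ s : ℕ) : ℝ) * ((2 ^ ℓe : ℕ) : ℝ) ^ (T - (t : ℕ)))) (2 * (u : ℝ) / ((2 ^ ℓe : ℕ) : ℝ))),
        corrMass Q F₁ ((2 ^ (top + (ℓy - s)) * (k₀ + 2 ^ s * ν) : ℕ) : ℤ) / (Q : ℝ) ^ 2 ≤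
      ∑ k₀ ∈ (range (2 ^ s)).filter tail, corrMass Q F₁ ((2 ^ (top + (ℓy - s)) * (k₀ + 2 ^ s * ν) : ℕ) : ℤ) / (Q : ℝ) ^ 2 +
      ∑ k₀ ∈ (range (2 ^ s)).filter (fun k₀ => ¬ tail k₀ ∧ off k₀ ν),
        corrMass Q F₁ ((2 ^ (top + (ℓy - s)) * (k₀ + 2 ^ s * ν) : ℕ) : ℤ) / (Q : ℝ) ^ 2 := by
    intro ν hν
    have hsub : (range (2 ^ s)).filter (fun k₀ => 2 ^ (top + (ℓy - s)) * (k₀ + 2 ^ s * ν) ∉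
        AccAll ⟨T, ℓe, s, ℓy - s, top, K₀, hB⟩ Λ
          (fun t => μ t + 1 / (((2 ^ s : ℕ) : ℝ) * ((2 ^ ℓe : ℕ) : ℝ) ^ (T - (t : ℕ)))) (2 * (u : ℝ) / ((2 ^ ℓe : ℕ) : ℝ))) ⊆
        (range (2 ^ s)).filter tail ∪ (range (2 ^ s)).filter (fun k₀ => ¬ tail k₀ ∧ off k₀ ν) := by
      intro k₀ hk₀
      obtain ⟨hk₀S, hacc⟩ := mem_filter.1 hk₀
      rcases not_mem_AccAll_slice_imp T ℓe s (ℓy - s) top K₀ hB μ _ Λ (mem_range.1 hk₀S) (mem_range.1 hν) hK2 hacc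
        with ht | hnt
      · exact mem_union_left _ (mem_filter.2 ⟨hk₀S, ht⟩)
      · exact mem_union_right _ (mem_filter.2 ⟨hk₀S, hnt⟩)
    refine (sum_le_sum_of_subset_of_nonneg hsub fun _ _ _ => hw0 _).trans ?_
    have hui := sum_union_inter (s₁ := (range (2 ^ s)).filter tail)
      (s₂ := (range (2 ^ s)).filter (fun k₀ => ¬ tail k₀ ∧ off k₀ ν))
      (f := fun k₀ => corrMass Q F₁ ((2 ^ (top + (ℓy - s)) * (k₀ + 2 ^ s * ν) : ℕ) : ℤ) / (Q : ℝ) ^ 2)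
    have hin : 0 ≤ ∑ k₀ ∈ (range (2 ^ s)).filter tail ∩ (range (2 ^ s)).filter (fun k₀ => ¬ tail k₀ ∧ off k₀ ν),
        corrMass Q F₁ ((2 ^ (top + (ℓy - s)) * (k₀ + 2 ^ s * ν) : ℕ) : ℤ) / (Q : ℝ) ^ 2 := sum_nonneg fun _ _ => hw0 _
    linarith
  -- the tail mass
  have htailM : ∑ k₀ ∈ (range (2 ^ s)).filter tail, ∑ ν ∈ range (2 ^ (ℓe * T)),
      corrMass Q F₁ ((2 ^ (top + (ℓy - s)) * (k₀ + 2 ^ s * ν) : ℕ) : ℤ) / (Q : ℝ) ^ 2 ≤ 2 * (Ncell : ℝ) / K₀ := by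
    simp_rw [← sum_div]
    rw [div_le_iff₀ (by positivity), hWd, hQ]
    refine (shiftCell_tail_mass_le hMpos hS ha cls σ C y μ hC hσ hy' F₁ hF₁ hK1 hcells).trans (le_of_eq ?_)
    rw [← hQ, hQsq]
    have hK0 : (0 : ℝ) < K₀ := by exact_mod_cast hK1
    field_simp
  -- the off-ball mass
  have hoffM : ∑ k₀ ∈ (range (2 ^ s)).filter (fun k₀ => ¬ tail k₀), ∑ ν ∈ (range (2 ^ (ℓe * T))).filter (off k₀),
      corrMass Q F₁ ((2 ^ (top + (ℓy - s)) * (k₀ + 2 ^ s * ν) : ℕ) : ℤ) / (Q : ℝ) ^ 2 ≤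
      (hB : ℝ) ^ 2 * T / ((2 ^ ℓe : ℕ) : ℝ) + ((T : ℝ) / (u - 2) + 2 * (hB : ℝ) ^ 2 * (2 * u) ^ T / ((2 ^ ℓe : ℕ) : ℝ)) +
        2 * (1 + (hB : ℝ) ^ 2 * T / ((2 ^ ℓe : ℕ) : ℝ)) * (2 * Real.pi * K₀ / ((2 ^ s : ℕ) : ℝ)) := by
    simp_rw [← sum_div]
    rw [div_le_iff₀ (by positivity), hWd, hQ]
    have hkk : ∀ k₀ ∈ (range (2 ^ s)).filter (fun k₀ => ¬ tail k₀),
        (∃ m : ℤ, (k₀ : ℤ) = kkf k₀ + (2 ^ s : ℕ) * m) ∧ |kkf k₀| ≤ (K₀ : ℤ) := by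
      intro k₀ hk₀
      obtain ⟨hk₀S, hnt⟩ := mem_filter.1 hk₀
      have hk₀S' := mem_range.1 hk₀S
      simp only [htail, not_and_or, not_lt] at hnt
      by_cases hle : k₀ ≤ K₀
      · simp only [hkkf, if_pos hle]
        exact ⟨⟨0, by ring⟩, by rw [abs_of_nonneg (by positivity)]; exact_mod_cast hle⟩
      · simp only [hkkf, if_neg hle]
        refine ⟨⟨1, by ring⟩, ?_⟩
        rw [abs_of_nonpos (by omega)]
        rcases hnt with h | h
        · exact absurd h hle
        · omega
    have h := shiftCell_offBall_mass_sum_le hT0 hMpos hS ha Λ hhB cls σ C y μ hcls hC hσ hy' F₁ hF₁ hu3 huM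
      ((range (2 ^ s)).filter (fun k₀ => ¬ tail k₀)) (filter_subset _ _) kkf hkk
    refine h.trans (le_of_eq ?_)
    rw [← hQ, hQsq]
    ring
  -- assemble
  have hnum := samplingLaw_inaccurate_numerics hT h1 hu hM hN hKlo hKhi
  calc _ ≤ ∑ ν ∈ range (2 ^ (ℓe * T)), (∑ k₀ ∈ (range (2 ^ s)).filter tail,
          corrMass Q F₁ ((2 ^ (top + (ℓy - s)) * (k₀ + 2 ^ s * ν) : ℕ) : ℤ) / (Q : ℝ) ^ 2 +
        ∑ k₀ ∈ (range (2 ^ s)).filter (fun k₀ => ¬ tail k₀ ∧ off k₀ ν),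
          corrMass Q F₁ ((2 ^ (top + (ℓy - s)) * (k₀ + 2 ^ s * ν) : ℕ) : ℤ) / (Q : ℝ) ^ 2) := sum_le_sum hpt
    _ = ∑ k₀ ∈ (range (2 ^ s)).filter tail, ∑ ν ∈ range (2 ^ (ℓe * T)),
          corrMass Q F₁ ((2 ^ (top + (ℓy - s)) * (k₀ + 2 ^ s * ν) : ℕ) : ℤ) / (Q : ℝ) ^ 2 +
        ∑ k₀ ∈ (range (2 ^ s)).filter (fun k₀ => ¬ tail k₀), ∑ ν ∈ (range (2 ^ (ℓe * T))).filter (off k₀),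
          corrMass Q F₁ ((2 ^ (top + (ℓy - s)) * (k₀ + 2 ^ s * ν) : ℕ) : ℤ) / (Q : ℝ) ^ 2 := by
        rw [sum_add_distrib, sum_comm]
        congr 1
        have e1 : ∀ ν : ℕ, ∑ k₀ ∈ (range (2 ^ s)).filter (fun k₀ => ¬ tail k₀ ∧ off k₀ ν),
            corrMass Q F₁ ((2 ^ (top + (ℓy - s)) * (k₀ + 2 ^ s * ν) : ℕ) : ℤ) / (Q : ℝ) ^ 2 =
            ∑ k₀ ∈ (range (2 ^ s)).filter (fun k₀ => ¬ tail k₀),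
              (if off k₀ ν then corrMass Q F₁ ((2 ^ (top + (ℓy - s)) * (k₀ + 2 ^ s * ν) : ℕ) : ℤ) / (Q : ℝ) ^ 2 else 0) := by
          intro ν
          rw [← filter_filter, sum_filter]
        simp_rw [e1]
        rw [sum_comm]
        exact sum_congr rfl fun k₀ _ => (sum_filter _ _).symm
    _ ≤ 2 * (Ncell : ℝ) / K₀ + ((hB : ℝ) ^ 2 * T / ((2 ^ ℓe : ℕ) : ℝ) +
        ((T : ℝ) / (u - 2) + 2 * (hB : ℝ) ^ 2 * (2 * u) ^ T / ((2 ^ ℓe : ℕ) : ℝ)) +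
        2 * (1 + (hB : ℝ) ^ 2 * T / ((2 ^ ℓe : ℕ) : ℝ)) * (2 * Real.pi * K₀ / ((2 ^ s : ℕ) : ℝ))) := add_le_add htailM hoffM
    _ ≤ (1 / 2) ^ e₆ := hnum

include hTab hT hhB h1 hu hM hN hKlo hKhi in
/-- **Part (b)**: for every residue `kk` and dual vector `ξ`, the `w₁`-mass accurate for `(kk, ξ)` is at most
`(1 + 1/8)/[ℤ^T:Λ]` times the `w₁`-mass accurate for `kk`. [cite: Hallgren2005, §4] -/
theorem samplingLaw_uniform (kk : ℤ) (ξ : Fin T → ℚ) (hξ : ξ ∈ dualReps T Λ) :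
    ∑ c ∈ (range (2 ^ (top + (ℓy - s)) * (2 ^ s * 2 ^ (ℓe * T)))).filter (fun c => c ∈
        Acc ⟨T, ℓe, s, ℓy - s, top, K₀, hB⟩
          (fun t => μ t + 1 / (((2 ^ s : ℕ) : ℝ) * ((2 ^ ℓe : ℕ) : ℝ) ^ (T - (t : ℕ)))) (2 * (u : ℝ) / ((2 ^ ℓe : ℕ) : ℝ))
          kk ξ),
      corrMass ((2 ^ ℓe) ^ T * (2 ^ s * 2 ^ (top + (ℓy - s))))
          (fun v => C (cls (v % (2 ^ ℓe) ^ T)) ((σ (v % (2 ^ ℓe) ^ T) + v / (2 ^ ℓe) ^ T) % 2 ^ s)) c /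
        (((2 ^ ℓe) ^ T * (2 ^ s * 2 ^ (top + (ℓy - s))) : ℕ) : ℝ) ^ 2 ≤
      (1 + 1 / 8) / (Λ.index : ℝ) *
        ∑ c ∈ (range (2 ^ (top + (ℓy - s)) * (2 ^ s * 2 ^ (ℓe * T)))).filter (fun c => ∃ ξ' ∈ dualReps T Λ, c ∈
          Acc ⟨T, ℓe, s, ℓy - s, top, K₀, hB⟩
            (fun t => μ t + 1 / (((2 ^ s : ℕ) : ℝ) * ((2 ^ ℓe : ℕ) : ℝ) ^ (T - (t : ℕ)))) (2 * (u : ℝ) / ((2 ^ ℓe : ℕ) : ℝ))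
            kk ξ'),
        corrMass ((2 ^ ℓe) ^ T * (2 ^ s * 2 ^ (top + (ℓy - s))))
            (fun v => C (cls (v % (2 ^ ℓe) ^ T)) ((σ (v % (2 ^ ℓe) ^ T) + v / (2 ^ ℓe) ^ T) % 2 ^ s)) c /
          (((2 ^ ℓe) ^ T * (2 ^ s * 2 ^ (top + (ℓy - s))) : ℕ) : ℝ) ^ 2 := by
  obtain ⟨-, -, -, -, hcls, hC, hσ, hy, -⟩ := hTab
  obtain ⟨hu3, huM, hK1⟩ := samplingLaw_side (s := s) hT h1 hu hM hKhi
  have hT0 : 0 < T := hT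
  have hMpos : 0 < 2 ^ ℓe := pow_pos (by norm_num) _
  have hS : 0 < 2 ^ s := pow_pos (by norm_num) _
  have ha : 0 < 2 ^ (top + (ℓy - s)) := pow_pos (by norm_num) _
  have hW : 0 < (2 ^ ℓe) ^ T := pow_pos hMpos _
  have hWd : 2 ^ (ℓe * T) = (2 ^ ℓe) ^ T := pow_mul 2 ℓe T
  have hK2 : 2 * K₀ < 2 ^ s := by
    have h256 : 256 ≤ 2 ^ (e₆ + 8) * hB := by
      calc 256 = 2 ^ 8 * 1 := by norm_num
        _ ≤ 2 ^ (e₆ + 8) * hB := Nat.mul_le_mul (Nat.pow_le_pow_right (by norm_num) (by omega)) h1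
    nlinarith
  have hidx : 0 < Λ.index := Nat.pos_of_ne_zero AddSubgroup.FiniteIndex.index_ne_zero
  have hhR : (0 : ℝ) < Λ.index := by exact_mod_cast hidx
  set F₁ : ℕ → Ω := fun v => C (cls (v % (2 ^ ℓe) ^ T)) ((σ (v % (2 ^ ℓe) ^ T) + v / (2 ^ ℓe) ^ T) % 2 ^ s) with hF₁def
  set Q : ℕ := (2 ^ ℓe) ^ T * (2 ^ s * 2 ^ (top + (ℓy - s))) with hQ
  have hF₁ : ∀ E < (2 ^ ℓe) ^ T, ∀ j < 2 ^ s * 2 ^ (top + (ℓy - s)), F₁ (E + (2 ^ ℓe) ^ T * j) = C (cls E) ((σ E + j) % 2 ^ s) :=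
    fun E hE j _ => idealised_shiftCell hW cls σ C E hE j
  have hy' : ∀ E < (2 ^ ℓe) ^ T, ∀ E' < (2 ^ ℓe) ^ T, cls E = cls E' → ∃ z : ℤ, y E' - y E + ((2 ^ s : ℕ) : ℝ) *
      ∑ t : Fin T, μ t * (((E' / (2 ^ ℓe) ^ (t : ℕ) % 2 ^ ℓe : ℕ) : ℝ) - ((E / (2 ^ ℓe) ^ (t : ℕ) % 2 ^ ℓe : ℕ) : ℝ)) =
      ((2 ^ s : ℕ) : ℝ) * z := by
    intro E hE E' hE' h
    obtain ⟨z, hz⟩ := hy E hE E' hE' h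
    exact ⟨z, by push_cast; exact hz⟩
  have hQR : (0 : ℝ) < (Q : ℝ) := by rw [hQ]; positivity
  have hw0 : ∀ c : ℕ, 0 ≤ corrMass Q F₁ c / (Q : ℝ) ^ 2 := fun c => div_nonneg (corrMass_nonneg _ _ _) (sq_nonneg _)
  have hRHS0 : 0 ≤ ∑ c ∈ (range (2 ^ (top + (ℓy - s)) * (2 ^ s * 2 ^ (ℓe * T)))).filter (fun c => ∃ ξ' ∈ dualReps T Λ, c ∈
          Acc ⟨T, ℓe, s, ℓy - s, top, K₀, hB⟩
            (fun t => μ t + 1 / (((2 ^ s : ℕ) : ℝ) * ((2 ^ ℓe : ℕ) : ℝ) ^ (T - (t : ℕ)))) (2 * (u : ℝ) / ((2 ^ ℓe : ℕ) : ℝ))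
            kk ξ'), corrMass Q F₁ c / (Q : ℝ) ^ 2 := sum_nonneg fun c _ => hw0 c
  by_cases hex : ∃ k₀ < 2 ^ s, (k₀ ≤ K₀ ∧ kk = k₀) ∨ (2 ^ s - K₀ ≤ k₀ ∧ kk = (k₀ : ℤ) - (2 ^ s : ℕ))
  · obtain ⟨k₀, hk₀, hval⟩ := hex
    -- both sides are sums over one slice
    have eL := filter_range_Acc_eq_image T ℓe s (ℓy - s) top K₀ hB μ (2 * (u : ℝ) / ((2 ^ ℓe : ℕ) : ℝ))
      (fun ξ' => ξ' = ξ) hk₀ hK2 kk hval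
    have eR := filter_range_Acc_eq_image T ℓe s (ℓy - s) top K₀ hB μ (2 * (u : ℝ) / ((2 ^ ℓe : ℕ) : ℝ))
      (fun ξ' => ξ' ∈ dualReps T Λ) hk₀ hK2 kk hval
    beta_reduce at eL eR
    simp only [exists_eq_left] at eL
    have hinj : ∀ ν₁ ν₂ : ℕ, 2 ^ (top + (ℓy - s)) * (k₀ + 2 ^ s * ν₁) = 2 ^ (top + (ℓy - s)) * (k₀ + 2 ^ s * ν₂) → ν₁ = ν₂ :=
      fun ν₁ ν₂ h => Nat.eq_of_mul_eq_mul_left hS (Nat.add_left_cancel (Nat.eq_of_mul_eq_mul_left ha h))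
    rw [eL, eR, sum_image fun ν₁ _ ν₂ _ h => hinj ν₁ ν₂ h, sum_image fun ν₁ _ ν₂ _ h => hinj ν₁ ν₂ h, hWd]
    -- the ball law of the slice
    have hkk : ∃ m : ℤ, (k₀ : ℤ) = kk + (2 ^ s : ℕ) * m := by
      rcases hval with ⟨-, h⟩ | ⟨-, h⟩
      · exact ⟨0, by rw [h]; ring⟩
      · exact ⟨1, by rw [h]; ring⟩
    have hkkK : |kk| ≤ (K₀ : ℤ) := by
      rcases hval with ⟨h0, h⟩ | ⟨h0, h⟩
      · rw [h, abs_of_nonneg (by positivity)]; exact_mod_cast h0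
      · rw [h, abs_of_nonpos (by omega)]; omega
    obtain ⟨hξ01, hξint⟩ := hξ
    have hnum := samplingLaw_ball_numerics hT h1 hu hM hN hKlo hKhi
    have hball := shiftCell_ball_mass_le hT0 hMpos hS ha Λ hhB cls σ C y μ hcls hC hσ hy' F₁ hF₁ hu3 huM k₀ kk hkk hkkK
      hnum ξ hξ01 hξint
    rw [← hQ] at hball
    have key : ∀ A B : ℝ, 8 * (Λ.index : ℝ) * A ≤ 9 * B →
        A / (Q : ℝ) ^ 2 ≤ (1 + 1 / 8) / (Λ.index : ℝ) * (B / (Q : ℝ) ^ 2) := by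
      intro A B hAB
      have h1' : A ≤ 9 * B / (8 * Λ.index) := by rw [le_div_iff₀ (by positivity)]; linarith
      calc A / (Q : ℝ) ^ 2 ≤ (9 * B / (8 * Λ.index)) / (Q : ℝ) ^ 2 := div_le_div_of_nonneg_right h1' (by positivity)
        _ = (1 + 1 / 8) / (Λ.index : ℝ) * (B / (Q : ℝ) ^ 2) := by field_simp; ring
    rw [← sum_div, ← sum_div]
    exact key _ _ hball
  · have e0 := filter_range_Acc_eq_empty T ℓe s (ℓy - s) top K₀ hB μ (2 * (u : ℝ) / ((2 ^ ℓe : ℕ) : ℝ))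
      (fun ξ' => ξ' = ξ) hK2 kk hex
    beta_reduce at e0
    simp only [exists_eq_left] at e0
    rw [e0, sum_empty]
    exact mul_nonneg (by positivity) hRHS0

end Parts

end CubicClassSampling

end Literature.Computability.Cryptography
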